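import Summits.CriticalPhenomena.CardyFormulaZ2.Theorems.CardyComplexConeEdgePrecompactUFRSArmDomination
import Summits.CriticalPhenomena.CardyFormulaZ2.Theorems.CardyComplexConeEdgePrecompactUFRSBigonTurning

/-!
# The slipped return: the first merge of the second run into the outgoing stretch, and its last merge
(line `qkz-strip-boundary-arm` of crux `CardyComplexCone.EdgePrecompact`, stmt-CriticalPhenomena-11387;
deterministic structure of the registered residual `ufrs_slippedReturnCase_cert` of the corrected
arm domination `ufrs_armDomination2`, see `…UFRSArmDominationResiduals.lean`,
`…UFRSArmDominationSplit.lean` and item 2 of the correction in `…UFRSAnnulusCrossings.lean`)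

Setting of the residual (B) "slipped return": the simple first stretch `S₀ = O₀ a [0, n]` of the
completed dynamics `β₀` of `E`, re-entering the ball at `n`; the split corner `e = O₀ a m`
(`m < n`, `cTgt e` a discrepancy edge); the run `O₁ e [0, T]` of the completed dynamics `β₁` of the
translate `shiftData E w`, which ENDS AT the re-entry corner, `O₁ e T = O₀ a n`; and the mismatch
clause — every contact `O₁ e j = O₀ a j₀` with the OUTGOING stretch `R₀ = O₀ a (m, n]` has
`∑_{i<j} turn₁ ≠ ∑_{i∈[m,j₀)} turn₀`. The road map (item 2 of the correction) builds the bigon at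
the first contact of the run with the WHOLE stretch `S₀`; that contact may be with the incoming
whisker `O₀ a [0, m)` (`whiskerContact`), where the mismatch clause says nothing. This file
records the two contacts with `R₀` that DO carry a mismatch, for arbitrary dynamics first:

* `firstRunMerge` — the FIRST contact `O₁ e j₁ = O₀ a i₁` with `R₀` (`1 ≤ j₁ ≤ T`, `m < i₁ ≤ n`,
  no corner of `O₁ e [0, j₁)` on `R₀`): a MERGE — the predecessors `O₀ a (i₁ - 1) ≠ O₁ e (j₁ - 1)`
  are the two opposite in-darts of one medial vertex, sent to the same corner by the two
  dynamics, so that edge is a discrepancy edge (`cTgt_not_iff_of_nextCorner_eq`); `i₁ = m + 1`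
  (the run returning to `cTgt e` through the opposite in-dart) is allowed;
* `lastRunMerge` — the LAST merge: the run and the stretch share a final segment
  `O₁ e (T - u') = O₀ a (n - u')`, `u' ≤ u`, of length `u < T` with `m + u + 1 ≤ n`, entered
  through the two opposite in-darts `O₀ a (n - u - 1) ≠ O₁ e (T - u - 1)` of a discrepancy edge
  (the agreement cannot reach back to `e`: the run is simple and splits at `e`).

In UFRS both merge vertices lie in the `3η`-collar (`ufrs_mergeCollar`), the window turning sums of
the first merge differ (the mismatch clause at the contact), and the last merge is where the run
starts riding the first stretch from a collar point all the way into the `2ρ`-deep ball. CAVEAT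
(analysis of worker W-SR, lead c5 wave 2, see the STATUS file of the residual): the divergent window
of the first merge (`P = O₀ a (m, i₁)`, `Q = O₁ e (0, j₁)`, corner-disjoint) is a cusp-free closed
medial polygon `J`, and a nonzero window difference does put the in-dart `e` or the out-dart
`O₀ a i₁` on the inner side of `J`; but the incoming whisker `O₀ a [0, m)` may CROSS `J` (it can
share a segment of `Q`: merge into `Q` at one collar discrepancy edge, split off on the other side
at the next), so "`e` inside `J`" does not trap the whisker, and window differences `±2π` ARE
realised by purely local configurations when the corner `e` is not synchronised (simulation). The
planar input that the residual really needs is the open-arc form of the Umlaufsatz for the two FULL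
explorations (from `a`, `a'` to the common final dart): the difference of the turning sums of two
simple medial arcs with common first and last darts is `2π` times the sum of the winding numbers of
their union around the point behind the start and the point beyond the end, whatever the contacts
in between; with the synchronisation at `e` this forces an excursion cycle of the translate's
exploration relative to `S₀` to surround the ball (or the start), whence the strands.

References: S. Smirnov, C. R. Acad. Sci. Paris 333 (2001), §2; G. Grimmett, *The Random-Cluster
Model* (2006), §6.1; H. Hopf, Compositio Math. 2 (1935).
-/

namespace Summit.CriticalPhenomena.CardyFormulaZ2.Cruxes.EdgePrecompact.QkzStripBoundaryArm

open MeasureTheory Filter Set Metric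
open scoped Topology BigOperators Pointwise
open Literature.Probability.LatticeModels Literature.Probability.Percolation
open Literature.Probability.RandomPlanarGeometry (DobrushinDomain)
open Summit.CriticalPhenomena.CardyFormulaZ2.Theses.CardyComplexCone

noncomputable section

/-! ## The first merge of the run into the outgoing stretch -/

/-- **First merge into the outgoing stretch** (combinatorial core, arbitrary dynamics `β₀, β₁`).
Data: a stretch `O₀ c₀ [0, n]` visiting pairwise distinct corners, a corner `e = O₀ c₀ m`, `m < n`,
at which the second dynamics splits off (`O₁ e 1 ≠ O₀ c₀ (m + 1)`), and a time `T` at which the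
run is back on the stretch at its end: `O₁ e T = O₀ c₀ n`. CONCLUSION: there is a first contact
`O₁ e j₁ = O₀ c₀ i₁` with the outgoing part (`1 ≤ j₁ ≤ T`, `m < i₁ ≤ n`, no corner `O₁ e j`,
`j < j₁`, equals a corner `O₀ c₀ i`, `m < i ≤ n`), and it is a merge: distinct predecessors — the
two opposite in-darts of one medial vertex — with a common successor, their common target edge of
different status in `β₀` and `β₁`. -/
theorem firstRunMerge : ∀ (β₀ β₁ : BondConfig (Site 2)) (c₀ e : Site 2 × Fin 4) (m n T : ℕ), m < n →
    cornerOrbit β₀ c₀ m = e →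
    (∀ i₁ i₂ : ℕ, i₁ ≤ n → i₂ ≤ n → cornerOrbit β₀ c₀ i₁ = cornerOrbit β₀ c₀ i₂ → i₁ = i₂) →
    cornerOrbit β₁ e 1 ≠ cornerOrbit β₀ c₀ (m + 1) →
    cornerOrbit β₁ e T = cornerOrbit β₀ c₀ n →
    ∃ j₁ i₁ : ℕ, 1 ≤ j₁ ∧ j₁ ≤ T ∧ m < i₁ ∧ i₁ ≤ n ∧ cornerOrbit β₁ e j₁ = cornerOrbit β₀ c₀ i₁ ∧
      (∀ j < j₁, ∀ i, m < i → i ≤ n → cornerOrbit β₁ e j ≠ cornerOrbit β₀ c₀ i) ∧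
      cornerOrbit β₀ c₀ (i₁ - 1) ≠ cornerOrbit β₁ e (j₁ - 1) ∧
      nextCorner β₀ (cornerOrbit β₀ c₀ (i₁ - 1)) = nextCorner β₁ (cornerOrbit β₁ e (j₁ - 1)) ∧
      cTgt (cornerOrbit β₀ c₀ (i₁ - 1)) = cTgt (cornerOrbit β₁ e (j₁ - 1)) ∧
      cornerOrbit β₁ e (j₁ - 1) = ((cornerOrbit β₀ c₀ (i₁ - 1)).1 + cornerUnit ((cornerOrbit β₀ c₀ (i₁ - 1)).2 + 1), (cornerOrbit β₀ c₀ (i₁ - 1)).2 + 2) ∧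
      ¬ (cTgt (cornerOrbit β₀ c₀ (i₁ - 1)) ∈ β₀ ↔ cTgt (cornerOrbit β₀ c₀ (i₁ - 1)) ∈ β₁) := by
  intro β₀ β₁ c₀ e m n T hmn he hsimple hsplit hend
  classical
  -- `T ≥ 1`: otherwise `e = O₀ c₀ n`, i.e. `m = n`
  have hT : 1 ≤ T := by
    rcases Nat.eq_zero_or_pos T with hT0 | h
    · exfalso
      rw [hT0] at hend
      have h0 : cornerOrbit β₀ c₀ m = cornerOrbit β₀ c₀ n := by rw [he]; exact hend
      have := hsimple m n hmn.le le_rfl h0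
      omega
    · exact h
  have hex : ∃ j, (1 ≤ j ∧ j ≤ T) ∧ ∃ i, m < i ∧ i ≤ n ∧ cornerOrbit β₁ e j = cornerOrbit β₀ c₀ i :=
    ⟨T, ⟨hT, le_rfl⟩, n, hmn, le_rfl, hend⟩
  obtain ⟨⟨hj1, hjT⟩, i₁, hmi, hin, hEq⟩ := Nat.find_spec hex
  have hmin : ∀ j < Nat.find hex, ¬ ((1 ≤ j ∧ j ≤ T) ∧ ∃ i, m < i ∧ i ≤ n ∧ cornerOrbit β₁ e j = cornerOrbit β₀ c₀ i) :=
    fun j hj => Nat.find_min hex hj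
  generalize Nat.find hex = j₁ at hj1 hjT hEq hmin
  have hfirst : ∀ j < j₁, ∀ i, m < i → i ≤ n → cornerOrbit β₁ e j ≠ cornerOrbit β₀ c₀ i := by
    intro j hj i hmi' hin' h
    rcases Nat.eq_zero_or_pos j with hj0 | hjpos
    · -- `O₁ e 0 = e = O₀ c₀ m`
      rw [hj0] at h
      have h0 : cornerOrbit β₀ c₀ m = cornerOrbit β₀ c₀ i := by rw [he]; exact h
      have := hsimple m i hmn.le hin' h0
      omega
    · exact hmin j hj ⟨⟨hjpos, le_trans hj.le hjT⟩, i, hmi', hin', h⟩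
  have hi1 : 1 ≤ i₁ := by omega
  -- the predecessors are distinct
  have hne : cornerOrbit β₀ c₀ (i₁ - 1) ≠ cornerOrbit β₁ e (j₁ - 1) := by
    intro h
    rcases Nat.lt_or_ge m (i₁ - 1) with hlt | hge
    · exact hfirst (j₁ - 1) (by omega) (i₁ - 1) hlt (by omega) h.symm
    · -- `i₁ = m + 1`: the run would return to `e` and restart along `O₀ c₀ (m + 1)`
      have him : i₁ - 1 = m := by omega
      rw [him, he] at h
      have h2 : cornerOrbit β₁ e (j₁ - 1 + 1) = cornerOrbit β₁ e (0 + 1) := by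
        show nextCorner β₁ (cornerOrbit β₁ e (j₁ - 1)) = nextCorner β₁ (cornerOrbit β₁ e 0)
        rw [← h]
        rfl
      rw [Nat.sub_add_cancel hj1, zero_add] at h2
      apply hsplit
      rw [← h2, hEq, show i₁ = m + 1 by omega]
  have hnext : nextCorner β₀ (cornerOrbit β₀ c₀ (i₁ - 1)) = nextCorner β₁ (cornerOrbit β₁ e (j₁ - 1)) := by
    show cornerOrbit β₀ c₀ (i₁ - 1 + 1) = cornerOrbit β₁ e (j₁ - 1 + 1)
    rw [Nat.sub_add_cancel hi1, Nat.sub_add_cancel hj1]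
    exact hEq.symm
  obtain ⟨htgt, hopp, hst⟩ := cTgt_not_iff_of_nextCorner_eq hne hnext
  exact ⟨j₁, i₁, hj1, hjT, hmi, hin, hEq, hfirst, hne, hnext, htgt, hopp, hst⟩

/-! ## The last merge: the common final segment -/

/-- **Last merge: the common final segment** (combinatorial core, arbitrary dynamics). Data as in
`firstRunMerge`, plus injectivity of the run on `[0, T]`. CONCLUSION: there is `u < T` with
`m + u + 1 ≤ n` such that the run and the stretch agree on their last `u + 1` corners,
`O₁ e (T - u') = O₀ c₀ (n - u')` for `u' ≤ u`, and the corners before, `O₀ c₀ (n - u - 1)` and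
`O₁ e (T - u - 1)`, are distinct — the two opposite in-darts of one medial vertex, with a common
successor and a common target edge of different status in `β₀` and `β₁`. (The agreement cannot
extend back to `e = O₁ e 0`: by injectivity of the run that would force `T = n - m` and
`O₁ e 1 = O₀ c₀ (m + 1)`, contradicting the split.) -/
theorem lastRunMerge : ∀ (β₀ β₁ : BondConfig (Site 2)) (c₀ e : Site 2 × Fin 4) (m n T : ℕ), m < n →
    cornerOrbit β₀ c₀ m = e →
    (∀ i₁ i₂ : ℕ, i₁ ≤ n → i₂ ≤ n → cornerOrbit β₀ c₀ i₁ = cornerOrbit β₀ c₀ i₂ → i₁ = i₂) →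
    (∀ j₁ j₂ : ℕ, j₁ ≤ T → j₂ ≤ T → cornerOrbit β₁ e j₁ = cornerOrbit β₁ e j₂ → j₁ = j₂) →
    cornerOrbit β₁ e 1 ≠ cornerOrbit β₀ c₀ (m + 1) →
    cornerOrbit β₁ e T = cornerOrbit β₀ c₀ n →
    ∃ u : ℕ, u < T ∧ m + u + 1 ≤ n ∧ (∀ u' ≤ u, cornerOrbit β₁ e (T - u') = cornerOrbit β₀ c₀ (n - u')) ∧
      cornerOrbit β₀ c₀ (n - u - 1) ≠ cornerOrbit β₁ e (T - u - 1) ∧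
      nextCorner β₀ (cornerOrbit β₀ c₀ (n - u - 1)) = nextCorner β₁ (cornerOrbit β₁ e (T - u - 1)) ∧
      cTgt (cornerOrbit β₀ c₀ (n - u - 1)) = cTgt (cornerOrbit β₁ e (T - u - 1)) ∧
      cornerOrbit β₁ e (T - u - 1) = ((cornerOrbit β₀ c₀ (n - u - 1)).1 + cornerUnit ((cornerOrbit β₀ c₀ (n - u - 1)).2 + 1), (cornerOrbit β₀ c₀ (n - u - 1)).2 + 2) ∧
      ¬ (cTgt (cornerOrbit β₀ c₀ (n - u - 1)) ∈ β₀ ↔ cTgt (cornerOrbit β₀ c₀ (n - u - 1)) ∈ β₁) := by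
  intro β₀ β₁ c₀ e m n T hmn he hsimple hrunsimple hsplit hend
  classical
  -- agreement back to `e` is impossible
  have key : ∀ u : ℕ, (∀ u' ≤ u, cornerOrbit β₁ e (T - u') = cornerOrbit β₀ c₀ (n - u')) → u < T ∧ m + u + 1 ≤ n := by
    intro u hagree
    -- agreement at `u' = n - m ≤ u` would give `O₁ e (T - (n - m)) = e`, so `T ≤ n - m`; then either the
    -- agreement at `u' = T` puts `e` on the stretch again, or `T = n - m` and `u' = n - m - 1` contradicts the split
    have hnm : ¬ n - m ≤ u := by
      intro hle
      have h := hagree (n - m) hle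
      rw [show n - (n - m) = m by omega, he] at h
      have hT : T - (n - m) = 0 := hrunsimple (T - (n - m)) 0 (Nat.sub_le _ _) (Nat.zero_le _) h
      rcases Nat.lt_or_ge T (n - m) with hlt | hge
      · have h2 := hagree T (by omega)
        rw [Nat.sub_self] at h2
        have h2' : cornerOrbit β₀ c₀ m = cornerOrbit β₀ c₀ (n - T) := by rw [he]; exact h2
        have := hsimple m (n - T) hmn.le (Nat.sub_le _ _) h2'
        omega
      · have h1 := hagree (n - m - 1) (by omega)
        rw [show T - (n - m - 1) = 1 by omega, show n - (n - m - 1) = m + 1 by omega] at h1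
        exact hsplit h1
    refine ⟨?_, by omega⟩
    -- agreement at `u' = T ≤ u` would give `e = O₀ c₀ (n - T)`, i.e. `n - m ≤ u` again
    by_contra hge
    rw [not_lt] at hge
    have h2 := hagree T hge
    rw [Nat.sub_self] at h2
    have h2' : cornerOrbit β₀ c₀ m = cornerOrbit β₀ c₀ (n - T) := by rw [he]; exact h2
    have := hsimple m (n - T) hmn.le (Nat.sub_le _ _) h2'
    omega
  have hex : ∃ f, ¬ cornerOrbit β₁ e (T - f) = cornerOrbit β₀ c₀ (n - f) := by
    by_contra hall
    have hall' : ∀ f, cornerOrbit β₁ e (T - f) = cornerOrbit β₀ c₀ (n - f) := fun f =>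
      not_not.1 (fun h => hall ⟨f, h⟩)
    have := (key (n - m) (fun u' _ => hall' u')).2
    omega
  have hf0 : Nat.find hex ≠ 0 := by
    intro h0
    have := Nat.find_spec hex
    rw [h0, Nat.sub_zero, Nat.sub_zero] at this
    exact this hend
  obtain ⟨u, hu⟩ : ∃ u, Nat.find hex = u + 1 := ⟨Nat.find hex - 1, by omega⟩
  have hfail : ¬ cornerOrbit β₁ e (T - (u + 1)) = cornerOrbit β₀ c₀ (n - (u + 1)) := by
    have := Nat.find_spec hex
    rwa [hu] at this
  have hagree : ∀ u' ≤ u, cornerOrbit β₁ e (T - u') = cornerOrbit β₀ c₀ (n - u') := fun u' hu' =>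
    not_not.1 (Nat.find_min hex (show u' < Nat.find hex by omega))
  obtain ⟨huT, hum⟩ := key u hagree
  have hne : cornerOrbit β₀ c₀ (n - u - 1) ≠ cornerOrbit β₁ e (T - u - 1) := by
    intro h
    apply hfail
    rw [show T - (u + 1) = T - u - 1 by omega, show n - (u + 1) = n - u - 1 by omega]
    exact h.symm
  have hnext : nextCorner β₀ (cornerOrbit β₀ c₀ (n - u - 1)) = nextCorner β₁ (cornerOrbit β₁ e (T - u - 1)) := by
    show cornerOrbit β₀ c₀ (n - u - 1 + 1) = cornerOrbit β₁ e (T - u - 1 + 1)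
    rw [show n - u - 1 + 1 = n - u by omega, show T - u - 1 + 1 = T - u by omega]
    exact (hagree u le_rfl).symm
  obtain ⟨htgt, hopp, hst⟩ := cTgt_not_iff_of_nextCorner_eq hne hnext
  exact ⟨u, huT, hum, hagree, hne, hnext, htgt, hopp, hst⟩

end

end Summit.CriticalPhenomena.CardyFormulaZ2.Cruxes.EdgePrecompact.QkzStripBoundaryArm
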